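import Summits.RiemannHypothesis.RiemannHypothesis.Theorems.WeilFormatCDataO109FrontData
import Summits.RiemannHypothesis.RiemannHypothesis.Theorems.S2FormatCE0
import Literature.NumberTheory.LFunctions.YoshidaWindowGramTailMSSines
import Literature.NumberTheory.LFunctions.YoshidaWindowGramMiddleJBox
import Literature.NumberTheory.LFunctions.YoshidaWindowGramTailJFactoredScaled
import Literature.NumberTheory.LFunctions.YoshidaWindowGramTailMSFactored
import Literature.NumberTheory.LFunctions.YoshidaWindowGramTailJDiagTight
import Summits.RiemannHypothesis.RiemannHypothesis.Theorems.FormatCPsdBands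
import Summits.RiemannHypothesis.RiemannHypothesis.Theorems.WeilFormatCDiagShift
import Summits.RiemannHypothesis.RiemannHypothesis.Theorems.FormatCPsdSymmBands
import HarnessLib

/-!
# Format C kernel rung `O109` (a = 109/100, column-band layout): odd sector: Schur rows 295…296 (lower triangle) of `M − U₁ − U₂` enclosed by `DS` within `rho`·2^-310 (kernel certificates)

Window `a = 109/100`; prime powers in the window: 2, 3, 2^2, 5, 7, 2^3; prime constant A = 2358/1000 (`WeilFormatC.primeCoeff_form_ge_cells_1098`); evaluator parameters S = 2^320, Kpi 160, Kser 190, kred 8, Kexp 55, J 150; full table modes < 321; light column table modes < 2051; units 2^-310 (Schur entries), 2^-154 (column digits, width 157), 2^-148 (tail-factor digits, width 151), 2^-64 (reciprocal weights), 2^-40 (tail base); order-J tail J = 4, θ = 1/2048, η = 1/10 | 4/1.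
Design row: sr-gb-rung-b B g22 hp odd λ-run = PARITY CELL 17 L-SIDE: a = 109/100 with SIX prime powers 2,3,4,5,7,8 (kmax 8; WeilFormatC.primeCoeff_form_ge_cells_1098, A = 2358/1000; 0.0086 below the (log 9)/2 resonance — the last full cell of this kit), μ = 2^-113 = 9.6e-35, odd 320/640/2048, kit precision S 2^320 / c 310 / Kpi 160 / Kser 190 / Kexp 55 / J 150 (A g23 hp levers), MS tail; probes (B g22): λ_min(DS) 8.15e-35 @ 109/100, 3.75e-34 @ 217/200 (Bo 320); see HOME(B)/CELL16-LSIDE-B-g22.md. Generated by sr-gb-rung-a prover A g22 with rh-explicit-weil-2 gen7's generator extended for the odd λ-run (--sector odd --mu-log2; HOME(A)/code-g22/gen7/gramgen7.py sha16 b22c17hp00000109) from `#eval` of the tree's `Encl` functions; every datum is re-verified by the kernel in the theorem files (`decide +kernel`). Helper data of the rh-explicit Weil-positivity programme (format C, K-CELL-2), RH-free. [cite: Yoshida1992HermitianForms, §5 (5.15)-(5.16) p. 301; §7 pp. 305–312]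
-/

set_option linter.dupNamespace false
set_option exponentiation.threshold 1024
set_option maxRecDepth 200000

namespace Summit.RiemannHypothesis.RiemannHypothesis.Theorems.WeilFormatCData.O109CBOdd
open Literature.NumberTheory.LFunctions Literature.NumberTheory.LFunctions.Yoshida1992 Encl Literature.Analysis.ValidatedNumerics.NumericsMP
open Summit.RiemannHypothesis.RiemannHypothesis.Theorems.WeilFormatCData.O109

/-- kernel: Schur rows `[295, 297)` (columns `j ≤ i`). -/
theorem tS295 : checkSchurBandG (2 ^ 320) 310 O109CBOdd.rho O109.C O109.tab true 320 (subBoxCB (2 ^ 320) 157 320 154 64 O109CBOdd.ρc O109CBOdd.XP O109CBOdd.Pd O109CBOdd.v O109CBOdd.V 151 8 148 148 O109CBOdd.ρφ O109CBOdd.ρψ O109CBOdd.ΦP O109CBOdd.ΨP O109CBOdd.Pφ O109CBOdd.Pψ (fun i ↦ (dMidOBox (2 ^ 320) O109.C O109.F (tget O109.tab (i + 1)) 1 1024 320 4 O109.momO i).add (dgJoBoxT (2 ^ 320) O109.C O109.F (tget O109.tab (i + 1)) 40 1577326692700 320 2048 4 1 2048 i))) O109CBOdd.DS true 295 2 = true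 := by
  decide +kernel

end Summit.RiemannHypothesis.RiemannHypothesis.Theorems.WeilFormatCData.O109CBOdd
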